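import Summits.BirchSwinnertonDyer.BirchSwinnertonDyer.Theorems.ManinLocalTwoThreeManinPrimeToAdditiveFiveLeStrongIsUnstarredOfAcrossIsogeny
import Summits.BirchSwinnertonDyer.BirchSwinnertonDyer.Theorems.ManinLocalTwoThreeManinPrimeToAdditiveFiveLeOrdinaryCornerOffTable
import Summits.BirchSwinnertonDyer.BirchSwinnertonDyer.Theorems.ManinLocalTwoThreeManinPrimeToAdditiveFiveLeSupersingularCornerTwistTransport
import Summits.BirchSwinnertonDyer.BirchSwinnertonDyer.Theorems.ManinLocalTwoThreeManinPrimeToAdditiveFiveLeAnchorRaynaudRowsOfTwistFamily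
import Summits.BirchSwinnertonDyer.BirchSwinnertonDyer.Theorems.ManinLocalTwoThreeManinPrimeToAdditiveFiveLeReducibleResidueThirteenStub
import Summits.BirchSwinnertonDyer.BirchSwinnertonDyer.Theorems.TwistFamilyManinDescentOrdinaryCornerOfSerreTateDepth
import Summits.BirchSwinnertonDyer.BirchSwinnertonDyer.Theorems.TwistFamilyManinDescentRaynaudRegimeOfOrientation
import Summits.BirchSwinnertonDyer.BirchSwinnertonDyer.Theorems.TwistFamilyManinDescentCornerResidualOfSupersingularTransport
import Summits.BirchSwinnertonDyer.BirchSwinnertonDyer.Theorems.TwistFamilyManinDescentEisensteinResidualOfTrichotomy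
import HarnessLib

/-!
# Route `ManinLocalTwoThree`, residual crux C5 `ManinPrimeToAdditiveFiveLe` (stmt-BirchSwinnertonDyer-22969), line `upper_anchor`
# (skeleton v14): **ČESNAVIČIUS–NEURURER–SAHA AND CREMONA'S TABLE LEAVE THE CONE** — C5 BY NAME ⟸ FIVE cite-only prints
# {Kato F″, Edixhoven Thm. 3 (Kodaira half, ordinarity half), Mazur's `j`-list, Dokchitser–Dokchitser 2015 Thm. 5.1 (1)} ∧ the registered items
# K15a (27072) ∧ K15b (27071) ∧ `OrdinaryCornerManinResidual` (27552) ∧ C1 (25939) ∧ C2 (26929) of route `TwistFamilyManinDescent`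

Lead seat bsd-line-ml23-c5-p1 (gen 7). In every earlier ledger of this line (v4–v13) the `W[p]`-reducible residual was CUT by Cremona's table
(`N > 5·10⁵`) and by ČNS Thm. 1.2 (`p ∣ deg φ`), and the cut statements RED(57♯) / RED(13♯) were then fed from the items. But the items that now
carry the residual — K15a, K15b, stmt-27552 at `p ∈ {5, 7}` (through the THEOREMS T17 p635594, OffTable p636035 and pub/bsd-wall's glues
p634960 / p635307 / the closed glue stmt-27096) and C1 ∧ C2 at `13` (pub/bsd-wall's `not_dvd_c_large`, p620618) — have NO level cut and NO
degree cut. So both prints are IDLE, and this file removes them: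

* `reducibleTwistMinimal_of_fourPrints_of_items` — the reducible twist-minimal residual of C5 (hypothesis `hRED` of the width seat's
  `maninLocalTwoThree_maninPrimeToAdditiveFiveLe_of_kato57_of_cores`, p611587, VERBATIM) ⟸ {EdK, EdG, MazurJ, D–D} ∧ K15a ∧ K15b ∧ 27552 ∧ C1 ∧ C2:
  at `p ∈ {5, 7}` the odd twist-minimality binder makes `W ⊗ p*` additive (`quadraticTwist_pStar_additive_of_twistMinimal`) and the row
  dispatch of route `TwistFamilyManinDescent`'s residual R applies — Raynaud rows by Ray57 (⟸ K15a ∧ K15b, glue 27096), the rest by Corner57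
  (⟸ T17 ∧ 27552 ∧ K15a ∧ Ray57, glue 27553); at `p > 7` pub/bsd-wall's `not_dvd_c_large` (starred ⟹ EdK; not (G)-ordinary ⟹ EdG; `p = 13` ⟹
  the lattice trichotomy from C1 ∧ C2 ∧ D–D), whose escape clause at `p ≠ 13` («no (G)-ordinary unstarred row») is Mazur's `j`-list read by
  the lead's gen-2 lemmas (`not_typeGOrd_of_not_hasIrreducibleModPGaloisRep_of_eleven_le` off `37`, `four_lt_padicValInt_…_thirtySeven` at `37`).
* `maninPrimeToAdditiveFiveLe_of_fivePrints_of_items` — **C5 BY NAME ⟸ {F″, EdK, EdG, MazurJ, D–D} ∧ K15a ∧ K15b ∧ 27552 ∧ C1 ∧ C2**: p611587 fed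
  with the irreducible locus from modularity ∧ F″ (`coreKP_of_kato`) and the residual above.
* `maninPrimeToAdditiveFiveLe_of_fivePrints_of_sevenLeaves` — the same with stmt-27552 unfolded into its LINE-18R leaves I9 (27660) ∧ K18a″
  (27661) ∧ K18b″ (27662) (glue 27664 + OffTable).

HONEST STATUS (`--supports`, helper): every print is a cite-only `def … : Prop` (F″ referee-flagged; D–D's `_holds` under construction by seat
bsd-line-ttd-p1), every item OPEN. Nothing here proves any item, C5, Manin's conjecture or BSD; the gain is two printed liabilities fewer
(Cremona's `N ≤ 5·10⁵` table with its «delicate classes» caveat, and ČNS 2024 Thm. 1.2) on C5's path of record.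

References: [Kato2004Asterisque] (8.1.3), Thm. 9.7; [EdixhovenManin1991] Thm. 3, §4; [Mazur1978] Thm. 1; [DokchitserDokchitser2015LocalInvariants]
Thm. 5.1 (1); [Stevens1989] §2; [KostersPannekoek2017] Thm. 1.
-/

set_option autoImplicit false
-- the Theorems namespace of this sub repeats the summit name by design (D-0017 nested layout)
set_option linter.dupNamespace false

noncomputable section

open scoped Classical NumberField

namespace Summit.BirchSwinnertonDyer.BirchSwinnertonDyer.Theorems

open WeierstrassCurve IsDedekindDomain NumberField Literature.NumberTheory.EllipticCurves
  Literature.NumberTheory.EllipticCurves.ModularForms Literature.NumberTheory.EllipticCurves.Rank1Residual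
  Summit.BirchSwinnertonDyer.Rank1Residual.ManinAdditive Summit.BirchSwinnertonDyer.Rank1Residual.Additive
  Summit.BirchSwinnertonDyer.BirchSwinnertonDyer.Theses.TwistFamilyManinDescent

/-- **The `W[p]`-reducible twist-minimal residual of C5 (hypothesis `hRED` of p611587, VERBATIM) ⟸ {EdK, EdG, MazurJ, D–D} ∧ K15a (27072) ∧ K15b
(27071) ∧ `OrdinaryCornerManinResidual` (27552) ∧ C1 (25939) ∧ C2 (26929)** — NO ČNS, NO Cremona table: `p ∈ {5, 7}` by the row dispatch of
route `TwistFamilyManinDescent`'s residual (Ray57 ⟸ K15a ∧ K15b; Corner57 ⟸ T17 ∧ 27552 ∧ K15a ∧ Ray57; `W ⊗ p*` additive from odd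
twist-minimality), `p > 7` by pub/bsd-wall's `not_dvd_c_large` with Mazur's `j`-list excluding the (G)-ordinary unstarred rows off `13`.
Conditional result on OPEN items and cite-only prints. [cite: EdixhovenManin1991, Thm. 3 and §4] [cite: Mazur1978, Thm. 1]
[cite: DokchitserDokchitser2015LocalInvariants, Thm. 5.1 (1)] -/
theorem reducibleTwistMinimal_of_fourPrints_of_items
    (hEdK : edixhoven_not_dvd_maninConstant_of_kodairaSymbol_ne)
    (hEdG : edixhoven_not_dvd_maninConstant_of_not_potentiallyGoodOrdinary)
    (hJ : mazur_j_mem_of_not_hasIrreducibleModPGaloisRep_of_eleven_le)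
    (hDD : dokchitser_padicValInt_minimalDiscriminantInt_eq_of_isogeny_of_potentiallyGoodOrdinary)
    (hK15a : SupersingularStrongIsUnstarred) (hK15b : SupersingularUnstarredStrongManinUnit)
    (hOrd : OrdinaryCornerManinResidual)
    (hC1 : EisensteinOrdinaryTwistLatticeNotBottom) (hC2 : EisensteinOrdinaryStrongIsTop) :
    mazur_not_dvd_maninConstant_of_odd → abbesUllmo_not_dvd_maninConstant_of_not_dvd_level →
    cesnavicius_not_two_dvd_maninConstant_of_two_dvd_level → exists_isNewformOf →
    ∀ (W : WeierstrassCurve ℚ) [W.IsElliptic] [W.IsGloballyMinimal] [NeZero (W.conductorNorm ℤ)]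
      (D : ModularParametrizationData W (W.conductorNorm ℤ)),
      IsLatticeOptimal D → ∀ p : ℕ, p.Prime → 5 ≤ p → p ^ 2 ∣ W.conductorNorm ℤ →
      ¬ (∃ (W' : WeierstrassCurve ℚ) (q : ℕ), W'.IsElliptic ∧ W'.IsGloballyMinimal ∧ q.Prime ∧
          q ≠ 2 ∧ q ^ 2 ∣ W.conductorNorm ℤ ∧
          IsIsogenous W (W'.quadraticTwist (((-1 : ℤ) ^ (q / 2) * q : ℤ) : ℚ)) ∧
          ¬ q ^ 2 ∣ W'.conductorNorm ℤ) →
      ¬ (∃ (W' : WeierstrassCurve ℚ) (d : ℤ), W'.IsElliptic ∧ W'.IsGloballyMinimal ∧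
          (d = -1 ∨ d = 2 ∨ d = -2) ∧ 2 ^ 2 ∣ W.conductorNorm ℤ ∧
          IsIsogenous W (W'.quadraticTwist (d : ℚ)) ∧ ¬ 2 ^ 2 ∣ W'.conductorNorm ℤ) →
      ¬ W.HasIrreducibleModPGaloisRep p →
      ¬ (p : ℤ) ∣ D.maninConstant := by
  have hRay : EisensteinRaynaudRegimeManinUnit := TwistFamilyManinDescent.raynaudRegimeOfOrientation_proof hK15a hK15b
  have hCor : EisensteinCornerManinResidual :=
    TwistFamilyManinDescent.cornerResidualOfSupersingularTransport_proof supersingularCornerTwistTransport_proof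
      hOrd hK15a hRay
  intro hM hAU hC hnf W _ _ _ D hD p hp h5 hpN hodd _hdy hred
  haveI hpF : Fact p.Prime := ⟨hp⟩
  have hp2 : p ≠ 2 := by omega
  by_cases h57 : p = 5 ∨ p = 7
  · -- `p ∈ {5, 7}`: `W ⊗ p*` is additive by odd twist-minimality; dispatch on the Raynaud rows
    have htw := quadraticTwist_pStar_additive_of_twistMinimal W hp hp2 hpN hodd
    rcases h57 with rfl | rfl
    · by_cases h58 : padicValInt 5 W.minimalDiscriminantInt ∈ ({4, 8} : Finset ℕ)
      · exact hRay hM hAU hC hnf W D 5 hp (Or.inl ⟨rfl, h58⟩) hpN hred htw hD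
      · refine hCor hM hAU hC hnf W D 5 hp (Or.inl rfl) ?_ hpN hred htw hD
        rintro (⟨-, h⟩ | ⟨h7, -⟩)
        · exact h58 h
        · norm_num at h7
    · by_cases h79 : padicValInt 7 W.minimalDiscriminantInt ∈ ({3, 9} : Finset ℕ)
      · exact hRay hM hAU hC hnf W D 7 hp (Or.inr ⟨rfl, h79⟩) hpN hred htw hD
      · refine hCor hM hAU hC hnf W D 7 hp (Or.inr rfl) ?_ hpN hred htw hD
        rintro (⟨h5', -⟩ | ⟨-, h⟩)
        · norm_num at h5'
        · exact h79 h
  · -- `p > 7`: Edixhoven's two forms off the (G)-ordinary unstarred rows, which Mazur's `j`-list empties off `13`; the core at `13`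
    obtain ⟨hne5, hne7⟩ := not_or.mp h57
    have hp6 : p ≠ 6 := by rintro rfl; norm_num at hp
    have hp8 : p ≠ 8 := by rintro rfl; norm_num at hp
    have hp9 : p ≠ 9 := by rintro rfl; norm_num at hp
    have hp10 : p ≠ 10 := by rintro rfl; norm_num at hp
    have h7 : 7 < p := by omega
    have h11 : 11 ≤ p := by omega
    have hadd : Addv W p := not_good_and_not_mult_of_sq_dvd_conductorNorm W hpN
    refine TwistFamilyManinDescent.EisensteinTrichotomy.not_dvd_c_large hnf hC1 hC2 hEdK hEdG hDD W p D h7 ?_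
      hpN hred hD
    intro hp13 hGv
    obtain ⟨hG, hv4⟩ := hGv
    by_cases hp37 : p = 37
    · subst hp37
      have h4 := four_lt_padicValInt_of_not_hasIrreducibleModPGaloisRep_thirtySeven W hJ hadd hred
      omega
    · exact not_typeGOrd_of_not_hasIrreducibleModPGaloisRep_of_eleven_le W p hJ h11 hp13 hp37 hadd hred hG

/-- **Crux C5 `ManinLocalTwoThree.ManinPrimeToAdditiveFiveLe` BY NAME ⟸ FIVE cite-only prints {Kato F″, EdK, EdG, MazurJ, D–D} ∧ K15a (27072) ∧
K15b (27071) ∧ `OrdinaryCornerManinResidual` (27552) ∧ C1 (25939) ∧ C2 (26929)** — the width seat's Kato reduction p611587 fed with the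
`W[p]`-irreducible locus from modularity ∧ F″ alone (`coreKP_of_kato`, pub/bsd-wall's `TeichmullerTwistDescent.not_dvd_c_of_kato`) and the reducible
residual of `reducibleTwistMinimal_of_fourPrints_of_items`. ČNS Thm. 1.2 and Cremona's table are NOT used. Conditional result (`--supports`, helper).
[cite: Kato2004Asterisque, (8.1.3) and Thm. 9.7] [cite: EdixhovenManin1991, Thm. 3] [cite: Mazur1978, Thm. 1]
[cite: DokchitserDokchitser2015LocalInvariants, Thm. 5.1 (1)] -/
theorem maninPrimeToAdditiveFiveLe_of_fivePrints_of_items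
    (hK57 : kato_neron_isIntegral_twistedSymbolSum_of_additive_five_le)
    (hEdK : edixhoven_not_dvd_maninConstant_of_kodairaSymbol_ne)
    (hEdG : edixhoven_not_dvd_maninConstant_of_not_potentiallyGoodOrdinary)
    (hJ : mazur_j_mem_of_not_hasIrreducibleModPGaloisRep_of_eleven_le)
    (hDD : dokchitser_padicValInt_minimalDiscriminantInt_eq_of_isogeny_of_potentiallyGoodOrdinary)
    (hK15a : SupersingularStrongIsUnstarred) (hK15b : SupersingularUnstarredStrongManinUnit)
    (hOrd : OrdinaryCornerManinResidual)
    (hC1 : EisensteinOrdinaryTwistLatticeNotBottom) (hC2 : EisensteinOrdinaryStrongIsTop) :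
    Summit.BirchSwinnertonDyer.BirchSwinnertonDyer.Theses.ManinLocalTwoThree.ManinPrimeToAdditiveFiveLe := by
  intro hM hAU hC hnf
  exact maninLocalTwoThree_maninPrimeToAdditiveFiveLe_of_kato57_of_cores hK57 (coreKP_of_kato hnf hK57)
    (reducibleTwistMinimal_of_fourPrints_of_items hEdK hEdG hJ hDD hK15a hK15b hOrd hC1 hC2) hM hAU hC hnf

/-- **C5 BY NAME ⟸ FIVE prints ∧ THE SEVEN LEAVES** {K15a 27072, K15b 27071, I9 27660, K18a″ 27661, K18b″ 27662, C1 25939, C2 26929}: the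
previous theorem with stmt-27552 assembled from its LINE-18R leaves (`TwistFamilyManinDescent.ordinaryCornerOfSerreTateDepth_proof`, glue
stmt-27664, fed with `ordinaryCornerOffTable_proof`, stmt-27663). Conditional result (`--supports`, helper). [cite: EdixhovenManin1991, Thm. 3 and §4] -/
theorem maninPrimeToAdditiveFiveLe_of_fivePrints_of_sevenLeaves
    (hK57 : kato_neron_isIntegral_twistedSymbolSum_of_additive_five_le)
    (hEdK : edixhoven_not_dvd_maninConstant_of_kodairaSymbol_ne)
    (hEdG : edixhoven_not_dvd_maninConstant_of_not_potentiallyGoodOrdinary)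
    (hJ : mazur_j_mem_of_not_hasIrreducibleModPGaloisRep_of_eleven_le)
    (hDD : dokchitser_padicValInt_minimalDiscriminantInt_eq_of_isogeny_of_potentiallyGoodOrdinary)
    (hK15a : SupersingularStrongIsUnstarred) (hK15b : SupersingularUnstarredStrongManinUnit)
    (hI9 : OrdinaryCornerOptimalSerreTateDeep) (hKa : OrdinaryCornerDeepEdixhovenDichotomy)
    (hKb : OrdinaryCornerDeepUnstarredNotBottom)
    (hC1 : EisensteinOrdinaryTwistLatticeNotBottom) (hC2 : EisensteinOrdinaryStrongIsTop) :
    Summit.BirchSwinnertonDyer.BirchSwinnertonDyer.Theses.ManinLocalTwoThree.ManinPrimeToAdditiveFiveLe :=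
  maninPrimeToAdditiveFiveLe_of_fivePrints_of_items hK57 hEdK hEdG hJ hDD hK15a hK15b
    (TwistFamilyManinDescent.ordinaryCornerOfSerreTateDepth_proof hI9 hKa hKb ordinaryCornerOffTable_proof) hC1 hC2

end Summit.BirchSwinnertonDyer.BirchSwinnertonDyer.Theorems

end
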